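import Literature.NumberTheory.PAdicHodge.TateAlmostEtaleIntegralBases
import HarnessLib

/-!
# The Frobenius-twisted power basis: `p`-th roots modulo `p^{s'}` from an almost self-dual basis
# (toward Tate's almost étale lemma, Tate 1967 §3.2 Prop. 9 / Berger–Colmez (TS1))

Notation as in `TateAlmostEtaleIntegralBases` (`K₀ ⊆ M ⊆ L ⊆ F̄`, `q = ‖p‖`). The almost-perfectoid
package `pkg_s(M)` is: (Γ) every `x ∈ M^×` has `c ∈ M` with `‖c‖^p = ‖x‖`; (U_s) every `u ∈ M` with
`‖u‖ ≤ 1` has `w ∈ M` with `‖u - w^p‖ ≤ q^s`. Main result: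

* `TateAlmostEtale.exists_norm_sub_pow_le_of_twisted_powerBasis` : if `L/M` has a power basis `pb`
  whose generator is `γ^p` for a UNIT `γ ∈ L`, whose different satisfies `‖f'(pb.gen)‖ ≥ q^δ`, and
  `pkg_s(M)` holds, then **every integer `u ∈ L` is `w^p + O(q^{min s 1 - δ})` for some `w ∈ L`**:
  expand `u = Σ λ_i (γ^i)^p` with `‖λ_i‖ ≤ q^{-δ}`, write `λ_i = c_i^p (w_i^p + O(q^s))` by the package, and
  take `w = Σ c_i w_i γ^i` (multinomial estimate `‖(Σ x_i)^p - Σ x_i^p‖ ≤ q B^p`).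

with the generic estimates it needs (`norm_sum_pow_sub_sum_pow_le'`, `norm_pow_sub_pow_eq` :
`‖x^p - y^p‖ = ‖x - y‖^p` when `‖x - y‖^p > q`), the norm `‖ζ - 1‖ = q^{1/(p-1)}` of a non-trivial
`p`-th root of unity (`norm_sub_one_of_pow_prime_eq_one`), This is the transfer mechanism "almost étale + pkg(M) ⇒ pkg(L)" of the
elementary route (used for Kummer `p`-steps in `TateAlmostEtalePackageStep`). Own argument; compare
Gabber–Ramero, *Almost ring theory* §6.6, Scholze 2012 Thm. 3.7. No `sorry`, no definitions.
References: [Tate1967] §3.2 Prop. 9; [BergerColmez2008] Prop. 4.1.1; [SerreLocalFields1979] IV §4.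
-/

noncomputable section

open Polynomial IntermediateField Module ValuativeRel Field

namespace Literature.NumberTheory.PAdicHodge

namespace TateAlmostEtale

open Literature.NumberTheory.GaloisRepresentations
open Literature.NumberTheory.GaloisRepresentations.IsNonarchimedeanLocalField

variable {F : Type} [Field F] [ValuativeRel F] [TopologicalSpace F] [IsNonarchimedeanLocalField F]
  [CharZero F] {p : ℕ} [Fact p.Prime] (hp : valuation F p < 1)
/-! ### Generic ultrametric estimates -/

section Generic

variable {E : Type*} [NormedField E] [IsUltrametricDist E]

/-- Multinomial estimate with a bound `B ≥ 1`: for `p` prime and `‖a_j‖ ≤ B`,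
`‖(Σ a_j)^p - Σ a_j^p‖ ≤ ‖p‖ B^p`. [cite: SerreLocalFields1979, Ch. IV §4] [cite: Tate1967, §3.1] -/
theorem norm_sum_pow_sub_sum_pow_le' {p : ℕ} (hp : p.Prime) {ι : Type*} (s : Finset ι) (f : ι → E)
    {B : ℝ} (hB : 1 ≤ B) (hf : ∀ i ∈ s, ‖f i‖ ≤ B) :
    ‖(∑ i ∈ s, f i) ^ p - ∑ i ∈ s, f i ^ p‖ ≤ ‖(p : E)‖ * B ^ p := by
  classical
  -- two-term estimate with bound `B`
  have two : ∀ a b : E, ‖a‖ ≤ B → ‖b‖ ≤ B → ‖(a + b) ^ p - a ^ p - b ^ p‖ ≤ ‖(p : E)‖ * B ^ p := by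
    intro a b ha hb
    have hexp : (a + b) ^ p - a ^ p - b ^ p =
        ∑ k ∈ Finset.range (p - 1), (p.choose (k + 1) : E) * (a ^ (k + 1) * b ^ (p - (k + 1))) := by
      obtain ⟨n, rfl⟩ : ∃ n, p = n + 2 := ⟨p - 2, (Nat.sub_add_cancel hp.two_le).symm⟩
      have h1 : n + 2 - 1 = n + 1 := rfl
      rw [h1, add_pow, Finset.sum_range_succ, Finset.sum_range_succ']
      simp only [pow_zero, Nat.sub_zero, one_mul, Nat.choose_zero_right, Nat.cast_one, mul_one,
        Nat.sub_self, Nat.choose_self]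
      rw [Finset.sum_congr rfl (fun k _ =>
        (mul_comm (a ^ (k + 1) * b ^ (n + 2 - (k + 1))) ((n + 2).choose (k + 1) : E)))]
      ring
    rw [hexp]
    refine IsUltrametricDist.norm_sum_le_of_forall_le_of_nonneg (by positivity) fun k hk => ?_
    rw [Finset.mem_range] at hk
    obtain ⟨m, hm⟩ := hp.dvd_choose_self (Nat.succ_ne_zero k) (by omega)
    rw [hm, Nat.cast_mul, norm_mul, norm_mul, norm_mul, norm_pow, norm_pow]
    have hmle : ‖(m : E)‖ ≤ 1 := IsUltrametricDist.norm_natCast_le_one E m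
    have hB0 : 0 ≤ B := zero_le_one.trans hB
    calc ‖(p : E)‖ * ‖(m : E)‖ * (‖a‖ ^ (k + 1) * ‖b‖ ^ (p - (k + 1)))
        ≤ ‖(p : E)‖ * 1 * (B ^ (k + 1) * B ^ (p - (k + 1))) := by
          gcongr
      _ = ‖(p : E)‖ * B ^ p := by
          rw [mul_one, ← pow_add, Nat.add_sub_cancel' (by omega)]
  induction s using Finset.induction_on with
  | empty => simp [hp.ne_zero]; positivity
  | @insert i s hi ih =>
    have hfi : ‖f i‖ ≤ B := hf i (Finset.mem_insert_self i s)
    have hfs : ∀ j ∈ s, ‖f j‖ ≤ B := fun j hj => hf j (Finset.mem_insert_of_mem hj)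
    have hS : ‖∑ j ∈ s, f j‖ ≤ B :=
      IsUltrametricDist.norm_sum_le_of_forall_le_of_nonneg (zero_le_one.trans hB) hfs
    rw [Finset.sum_insert hi, Finset.sum_insert hi]
    have : (f i + ∑ j ∈ s, f j) ^ p - (f i ^ p + ∑ j ∈ s, f j ^ p) =
        ((f i + ∑ j ∈ s, f j) ^ p - f i ^ p - (∑ j ∈ s, f j) ^ p) +
          ((∑ j ∈ s, f j) ^ p - ∑ j ∈ s, f j ^ p) := by ring
    rw [this]
    exact (IsUltrametricDist.norm_add_le_max _ _).trans (max_le (two _ _ hfi hS) (ih hfs))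

/-- Frobenius separates units that are not too close: for `p` prime, `‖x‖, ‖y‖ ≤ 1` and
`‖x - y‖^p > ‖p‖`, **`‖x^p - y^p‖ = ‖x - y‖^p`** (`x^p - y^p = (x-y)^p + O(p)`).
[cite: SerreLocalFields1979, Ch. IV §4] [cite: Tate1967, §3.1] -/
theorem norm_pow_sub_pow_eq {p : ℕ} (hp : p.Prime) {x y : E} (hx : ‖x‖ ≤ 1) (hy : ‖y‖ ≤ 1)
    (hxy : ‖(p : E)‖ < ‖x - y‖ ^ p) : ‖x ^ p - y ^ p‖ = ‖x - y‖ ^ p := by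
  set R : E := x ^ p - y ^ p - (x - y) ^ p with hR
  have hR1 : ‖R‖ ≤ ‖(p : E)‖ := by
    have h1 : ‖(x + -y) ^ p - x ^ p - (-y) ^ p‖ ≤ ‖(p : E)‖ :=
      norm_add_pow_sub_le hp x (-y) hx (by rw [norm_neg]; exact hy)
    have h2 : ‖(-y) ^ p + y ^ p‖ ≤ ‖(p : E)‖ := by
      rcases hp.eq_two_or_odd' with rfl | hodd
      · have : (-y) ^ 2 + y ^ 2 = (2 : ℕ) * y ^ 2 := by push_cast; ring
        rw [this, norm_mul, norm_pow]
        exact mul_le_of_le_one_right (norm_nonneg _) (pow_le_one₀ (norm_nonneg _) hy)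
      · rw [hodd.neg_pow, neg_add_cancel, norm_zero]; exact norm_nonneg _
    have : R = -((x + -y) ^ p - x ^ p - (-y) ^ p) - ((-y) ^ p + y ^ p) := by
      rw [hR, ← sub_eq_add_neg]; ring
    rw [this]
    refine (norm_sub_le_max' _ _).trans (max_le ?_ h2)
    rw [norm_neg]; exact h1
  have hxyp : x ^ p - y ^ p = (x - y) ^ p + R := by rw [hR]; ring
  have hne : ‖(x - y) ^ p‖ ≠ ‖R‖ := by
    rw [norm_pow]; exact (hR1.trans_lt hxy).ne'
  rw [hxyp, IsUltrametricDist.norm_add_eq_max_of_norm_ne_norm hne, norm_pow]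
  exact max_eq_left (hR1.trans hxy.le)

end Generic

/-! ### The twisted power basis -/

section KummerStep

variable (M : IntermediateField (PadicBase F p hp) (NormedAlgClosure F))

include hp in
/-- A `p`-th root of unity `ζ ≠ 1` in `F̄` has `‖ζ - 1‖ = ‖p‖^{1/(p-1)}`. [cite: SerreLocalFields1979, Ch. IV §4] -/
theorem norm_sub_one_of_pow_prime_eq_one {ζ : NormedAlgClosure F} (hζ : ζ ^ p = 1) (hζ1 : ζ ≠ 1) :
    ‖ζ - 1‖ = ‖(p : NormedAlgClosure F)‖ ^ (1 / ((p : ℝ) - 1)) := by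
  have hprime : p.Prime := Fact.out
  have hord : orderOf ζ = p := orderOf_eq_prime hζ hζ1
  have hprim : IsPrimitiveRoot ζ (p ^ 1) := by rw [pow_one, ← hord]; exact IsPrimitiveRoot.orderOf ζ
  rw [CyclotomicTower.norm_sub_one_eq_of_isPrimitiveRoot hprim, CyclotomicTower.norm_zeta_sub_one hp le_rfl,
    ← PadicBase.norm_natCast_closure hp, pow_one, Nat.totient_prime hprime, Nat.cast_sub hprime.one_le,
    Nat.cast_one]

include hp in
/-- **The Frobenius-twisted power basis gives `p`-th roots modulo `p^{min s 1 - δ}`.** Let `K₀ ⊆ M ⊆ L ⊆ F̄`,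
`L/M` finite with a power basis `pb` whose generator is `γ^p` for a unit `γ ∈ L`, and suppose the
different `f'(pb.gen)` (`f = minpoly`) has norm `≥ ‖p‖^δ`. If `M` satisfies (Γ) and (U_s), then every
`u ∈ L` with `‖u‖ ≤ 1` is `w^p + O(‖p‖^{min s 1 - δ})` for some `w ∈ L`: expand `u = Σ λ_i γ^{pi}` with
`‖λ_i‖ ≤ ‖p‖^{-δ}` (`norm_repr_mul_norm_derivative_le`) and take `w = Σ c_i w_i γ^i`.
[cite: Tate1967, §3.2 Prop. 9] [cite: BergerColmez2008, Prop. 4.1.1] -/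
theorem exists_norm_sub_pow_le_of_twisted_powerBasis
    (L : IntermediateField M (NormedAlgClosure F)) [FiniteDimensional M L] (pb : PowerBasis M L)
    {γ : NormedAlgClosure F} (hγL : γ ∈ L) (hγn : ‖γ‖ = 1)
    (hgen : ((pb.gen : L) : NormedAlgClosure F) = γ ^ p)
    {s δ : ℝ} (hs : 0 < s) (hδ0 : 0 ≤ δ)
    (hΓ : ∀ x ∈ M, x ≠ 0 → ∃ c ∈ M, ‖c‖ ^ p = ‖x‖)
    (hU : ∀ u ∈ M, ‖u‖ ≤ 1 → ∃ w ∈ M, ‖u - w ^ p‖ ≤ ‖(p : NormedAlgClosure F)‖ ^ s)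
    (hH : ‖(p : NormedAlgClosure F)‖ ^ δ ≤
      ‖((aeval pb.gen (derivative (minpoly M pb.gen)) : L) : NormedAlgClosure F)‖)
    {u : NormedAlgClosure F} (hu : u ∈ L) (hu1 : ‖u‖ ≤ 1) :
    ∃ w ∈ L, ‖u - w ^ p‖ ≤ ‖(p : NormedAlgClosure F)‖ ^ (min s 1 - δ) := by
  have hprime : p.Prime := Fact.out
  set q : ℝ := ‖(p : NormedAlgClosure F)‖ with hq
  have hp0 : (p : NormedAlgClosure F) ≠ 0 := Nat.cast_ne_zero.mpr hprime.ne_zero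
  have hq0 : 0 < q := norm_pos_iff.mpr hp0
  have hq1 : q < 1 := by rw [hq, PadicBase.norm_natCast_closure hp]; exact PadicBase.norm_p_lt_one hp
  have hp0r : (0 : ℝ) < p := by exact_mod_cast hprime.pos
  set θ : NormedAlgClosure F := γ ^ p with hθ
  have hθn : ‖θ‖ = 1 := by rw [hθ, norm_pow, hγn, one_pow]
  set H : L := aeval pb.gen (derivative (minpoly M pb.gen)) with hHdef
  have hHpos : 0 < ‖(H : NormedAlgClosure F)‖ := (Real.rpow_pos_of_pos hq0 δ).trans_le hH
  -- coordinates of `z = u` in the basis `θ^i`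
  set z : L := ⟨u, hu⟩ with hzdef
  have hlam : ∀ i : Fin pb.dim, ‖((pb.basis.repr z i : M) : NormedAlgClosure F)‖ ≤ q ^ (-δ) := by
    intro i
    have h := norm_repr_mul_norm_derivative_le hp M pb (by rw [hgen, hθn]) z i
    have h2 : ‖((pb.basis.repr z i : M) : NormedAlgClosure F)‖ ≤ 1 / ‖(H : NormedAlgClosure F)‖ := by
      rw [le_div_iff₀ hHpos]; exact h.trans hu1
    refine h2.trans ?_
    rw [Real.rpow_neg hq0.le, one_div]
    exact inv_anti₀ (Real.rpow_pos_of_pos hq0 δ) hH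
  -- termwise `p`-th roots
  have hterm : ∀ i : Fin pb.dim, ∃ x : NormedAlgClosure F, x ∈ L ∧ ‖x‖ ≤ q ^ (-δ / p) ∧
      ‖((pb.basis.repr z i : M) : NormedAlgClosure F) * θ ^ (i : ℕ) - x ^ p‖ ≤ q ^ (s - δ) := by
    intro i
    set lam : NormedAlgClosure F := ((pb.basis.repr z i : M) : NormedAlgClosure F) with hlamdef
    by_cases hlam0 : lam = 0
    · refine ⟨0, zero_mem _, by rw [norm_zero]; positivity, ?_⟩
      rw [hlam0, zero_mul, zero_pow hprime.ne_zero, sub_zero, norm_zero]; positivity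
    obtain ⟨cᵢ, hcᵢM, hcᵢ⟩ := hΓ lam (pb.basis.repr z i).2 hlam0
    have hcᵢ0 : cᵢ ≠ 0 := by
      intro h; rw [h, norm_zero, zero_pow hprime.ne_zero] at hcᵢ; exact hlam0 (norm_eq_zero.mp hcᵢ.symm)
    set uᵢ : NormedAlgClosure F := lam / cᵢ ^ p with huᵢ
    have huᵢ1 : ‖uᵢ‖ = 1 := by
      rw [huᵢ, norm_div, norm_pow, hcᵢ, div_self (norm_ne_zero_iff.mpr hlam0)]
    obtain ⟨wᵢ, hwᵢM, hwᵢ⟩ := hU uᵢ (div_mem (pb.basis.repr z i).2 (pow_mem hcᵢM p)) huᵢ1.le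
    have hwᵢ1 : ‖wᵢ‖ ≤ 1 := by
      have h1 : ‖wᵢ ^ p‖ ≤ 1 := by
        have : wᵢ ^ p = uᵢ - (uᵢ - wᵢ ^ p) := by ring
        rw [this]
        refine (norm_sub_le_max' _ _).trans (max_le huᵢ1.le (hwᵢ.trans ?_))
        exact Real.rpow_le_one hq0.le hq1.le hs.le
      rw [norm_pow] at h1
      exact (pow_le_one_iff_of_nonneg (norm_nonneg _) hprime.ne_zero).mp h1
    refine ⟨cᵢ * wᵢ * γ ^ (i : ℕ), ?_, ?_, ?_⟩
    · exact mul_mem (mul_mem (IntermediateField.algebraMap_mem L ⟨cᵢ, hcᵢM⟩)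
        (IntermediateField.algebraMap_mem L ⟨wᵢ, hwᵢM⟩)) (pow_mem hγL _)
    · rw [norm_mul, norm_mul, norm_pow, hγn, one_pow, mul_one]
      have h1 : ‖cᵢ‖ ≤ q ^ (-δ / p) := by
        calc ‖cᵢ‖ = (‖cᵢ‖ ^ p) ^ ((p : ℝ)⁻¹) :=
              (Real.pow_rpow_inv_natCast (norm_nonneg _) hprime.ne_zero).symm
          _ ≤ (q ^ (-δ)) ^ ((p : ℝ)⁻¹) := by
              rw [hcᵢ]; exact Real.rpow_le_rpow (norm_nonneg _) (hlam i) (inv_nonneg.mpr hp0r.le)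
          _ = q ^ (-δ / p) := by rw [← Real.rpow_mul hq0.le, div_eq_mul_inv]
      calc ‖cᵢ‖ * ‖wᵢ‖ ≤ q ^ (-δ / p) * 1 := by gcongr
        _ = q ^ (-δ / p) := mul_one _
    · have : lam * θ ^ (i : ℕ) - (cᵢ * wᵢ * γ ^ (i : ℕ)) ^ p =
          cᵢ ^ p * (γ ^ (i : ℕ)) ^ p * (uᵢ - wᵢ ^ p) := by
        rw [huᵢ, hθ, ← pow_mul, ← pow_mul, mul_comm (i : ℕ) p]
        field_simp
        ring
      rw [this, norm_mul, norm_mul, norm_pow, norm_pow, norm_pow, hγn, one_pow, one_pow, mul_one, hcᵢ]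
      calc ‖lam‖ * ‖uᵢ - wᵢ ^ p‖ ≤ q ^ (-δ) * q ^ s := by
            gcongr
            exact hlam i
        _ = q ^ (s - δ) := by rw [← Real.rpow_add hq0]; ring_nf
  choose x hxL hxn hxe using hterm
  -- the candidate `w = Σ x_i`
  refine ⟨∑ i, x i, sum_mem fun i _ => hxL i, ?_⟩
  have hzsum : u = ∑ i : Fin pb.dim, ((pb.basis.repr z i : M) : NormedAlgClosure F) * θ ^ (i : ℕ) := by
    have h := congrArg (fun y : L => (y : NormedAlgClosure F)) (pb.basis.sum_repr z)
    change ((z : L) : NormedAlgClosure F) = _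
    rw [← h]
    push_cast
    refine Finset.sum_congr rfl fun i _ => ?_
    rw [pb.basis_eq_pow i, Algebra.smul_def, IntermediateField.algebraMap_apply]
    push_cast
    rw [hgen]
  have hsd : ∑ i, (((pb.basis.repr z i : M) : NormedAlgClosure F) * θ ^ (i : ℕ) - x i ^ p) =
      (∑ i, ((pb.basis.repr z i : M) : NormedAlgClosure F) * θ ^ (i : ℕ)) - ∑ i, x i ^ p :=
    Finset.sum_sub_distrib _ _
  have hdecomp : u - (∑ i, x i) ^ p =
      ∑ i, (((pb.basis.repr z i : M) : NormedAlgClosure F) * θ ^ (i : ℕ) - x i ^ p)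
        + ((∑ i, x i ^ p) - (∑ i, x i) ^ p) := by
    rw [hsd, ← hzsum]; ring
  rw [hdecomp]
  have hB : (1 : ℝ) ≤ q ^ (-δ / p) :=
    Real.one_le_rpow_of_pos_of_le_one_of_nonpos hq0 hq1.le
      (div_nonpos_of_nonpos_of_nonneg (by linarith) hp0r.le)
  refine (IsUltrametricDist.norm_add_le_max _ _).trans (max_le ?_ ?_)
  · refine IsUltrametricDist.norm_sum_le_of_forall_le_of_nonneg (by positivity) fun i _ => ?_
    exact (hxe i).trans (Real.rpow_le_rpow_of_exponent_ge hq0 hq1.le (by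
      linarith [min_le_left s 1]))
  · rw [norm_sub_rev]
    refine (norm_sum_pow_sub_sum_pow_le' hprime _ _ hB fun i _ => hxn i).trans ?_
    rw [← Real.rpow_natCast (q ^ (-δ / p)) p, ← Real.rpow_mul hq0.le, div_mul_cancel₀ _ hp0r.ne']
    calc q * q ^ (-δ) = q ^ (1 - δ) := by
          rw [sub_eq_add_neg, Real.rpow_add hq0, Real.rpow_one]
      _ ≤ q ^ (min s 1 - δ) :=
          Real.rpow_le_rpow_of_exponent_ge hq0 hq1.le (by linarith [min_le_right s 1])

end KummerStep

end TateAlmostEtale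

end Literature.NumberTheory.PAdicHodge

end
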